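import Summits.ResolutionOfSingularities.ResolutionOfSingularities.Theorems.HomologicalConductorSurfaceTerminationGenusDomination
import HarnessLib

/-!
# Route `HomologicalConductor`, support `SurfaceTermination` (stmt-ResolutionOfSingularities-16488):
# chartwise vanishing of `Ȟ¹` over an affine open of REGULAR points

`[OURS · L W4.4]` Cell res-hironaka, crux chain W4.4, kill test K4.4-s; U2e-prep of res-L0-w44-stub-4 (the
`hvan` input of the (S)-step, `Literature/AlgebraicGeometry/Morphisms/CechH1PreimageGluing.lean`).  Nothing
here is a statement of the manuscript under review (Hironaka 2017); AI-written, weaker than expert review.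

* `cechZ1_le_cechB1_chart_of_forall_mem` — res-D-pv-045's `cechZ1_le_cechB1_chart`
  (`…SurfaceTerminationGenusDomination`) with the regularity and dimension hypotheses asked only AT THE
  POINTS of the affine open `U` (its proof, copied verbatim, uses them only there): for `ρ : Z → X` proper
  birational with `Z` regular, `U ⊆ X` affine all of whose points have regular local rings of dimension
  `≤ 2`, and a finite family `𝒢` of affine opens of `Z` with `⋃ 𝒢 = ρ⁻¹U` and affine pairwise and triple
  intersections: `Ȟ¹(𝒢, 𝒪_Z) = 0`, mod Lipman (1.2).  Use: `X = Spec N` the normalised chart of the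
  blowing up of `ca(T_(m+1))`, `U` an affine open avoiding the finitely many singular points of `N`.

References: J. Lipman, Publ. IHÉS 36 (1969), Prop. (1.2) [`Lipman1969`]; EGA III (1.4.15) [`EGAIII1`].
-/

noncomputable section
set_option linter.dupNamespace false

namespace Summit.ResolutionOfSingularities.ResolutionOfSingularities.Theorems.SurfaceTermination.GenusDescent

open CategoryTheory CategoryTheory.Limits AlgebraicGeometry TopologicalSpace IsLocalRing
open Literature.AlgebraicGeometry.Resolution Literature.AlgebraicGeometry.Morphisms
open Literature.AlgebraicGeometry.Morphisms.CechLocalization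

section ChartLocal

variable {T : Type} [CommRing T] {X Z : Scheme.{0}} [IsIntegral X] [NoetherianSpace X]
  [NoetherianSpace Z] (πX : X ⟶ Spec (.of T)) (ρ : Z ⟶ X) [IsProper ρ]

/-- **Chartwise `R¹ρ_*𝒪_Z = 0` over an affine open of REGULAR points** — the same as
`cechZ1_le_cechB1_chart` with the regularity and dimension hypotheses asked only AT THE POINTS OF `U`
(the proof of `cechZ1_le_cechB1_chart` uses them only there): for `ρ : Z → X` proper birational with `Z`
regular, an affine open `U ⊆ X` all of whose points have regular local rings of dimension `≤ 2`, and a finite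
family `𝒢` of affine opens of `Z` with `⋃ 𝒢 = ρ⁻¹U` and affine pairwise and triple intersections:
`Ȟ¹(𝒢, 𝒪_Z) = 0` (mod Lipman (1.2)).  Use (U2e, the (S)-step): `X = Spec N` the normalised chart, `U` an
affine open avoiding the finitely many singular points (res-L0-w44-stub-4).
[cite: Lipman1969, Proposition (1.2) 2) (p. 199)] -/
theorem cechZ1_le_cechB1_chart_of_forall_mem (h12 : Lipman1969_1_2.{0}) (hρ : IsBirational ρ)
    (hZ : Scheme.IsRegular Z) {U : X.Opens} (hU : IsAffineOpen U)
    (hX : ∀ x ∈ U, IsRegularLocalRing (X.presheaf.stalk x))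
    (hdimX : ∀ x ∈ U, ringKrullDim (X.presheaf.stalk x) ≤ 2)
    {κ : Type} [Finite κ] (G : κ → Z.Opens) (hGcov : ⨆ j, G j = ρ ⁻¹ᵁ U)
    (hG : ∀ j, IsAffineOpen (G j)) (hG2 : ∀ j j', IsAffineOpen (G j ⊓ G j'))
    (hG3 : ∀ j j' j'', IsAffineOpen (G j ⊓ G j' ⊓ G j'')) :
    cechZ1 (ρ ≫ πX) G ≤ cechB1 (ρ ≫ πX) G := by
  classical
  have hGle : ∀ j, G j ≤ ρ ⁻¹ᵁ U := fun j => hGcov ▸ le_iSup G j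
  -- (A) transport to the chart `ρ⁻¹U` along the open immersion `ι = (ρ⁻¹U).ι`
  have hbij : ∀ V : Z.Opens, V ≤ ρ ⁻¹ᵁ U →
      Function.Bijective (Sections.comap (ρ ≫ πX) ((ρ ⁻¹ᵁ U).ι ≫ ρ ≫ πX) (ρ ⁻¹ᵁ U).ι rfl
        (le_refl ((ρ ⁻¹ᵁ U).ι ⁻¹ᵁ V))) := by
    intro V hV
    have hVr : V ≤ (ρ ⁻¹ᵁ U).ι.opensRange := by rwa [Scheme.Opens.opensRange_ι]
    haveI := (ρ ⁻¹ᵁ U).ι.isIso_app V hVr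
    rw [show (Sections.comap (ρ ≫ πX) ((ρ ⁻¹ᵁ U).ι ≫ ρ ≫ πX) (ρ ⁻¹ᵁ U).ι rfl
        (le_refl ((ρ ⁻¹ᵁ U).ι ⁻¹ᵁ V)) : _ → _) = ((ρ ⁻¹ᵁ U).ι.app V).hom from by
      funext s; rw [Sections.comap_apply, Scheme.Hom.appLE_eq_app]]
    exact ConcreteCategory.bijective_of_isIso ((ρ ⁻¹ᵁ U).ι.app V)
  refine cechZ1_le_cechB1_of_comap (ρ ≫ πX) ((ρ ⁻¹ᵁ U).ι ≫ ρ ≫ πX) (ρ ⁻¹ᵁ U).ι rfl G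
    (fun j => (hbij (G j) (hGle j)).2)
    (fun j j' => (hbij (G j ⊓ G j') (inf_le_left.trans (hGle j))).1) ?_
  -- (B) regard the chart as a `Γ(X, U)`-scheme via `ρ ∣_ U`
  rw [cechZ1_le_cechB1_iff_of_base ((ρ ⁻¹ᵁ U).ι ≫ ρ ≫ πX) ((ρ ∣_ U) ≫ hU.isoSpec.hom)]
  have haffι : ∀ V : Z.Opens, V ≤ ρ ⁻¹ᵁ U → IsAffineOpen V →
      IsAffineOpen ((ρ ⁻¹ᵁ U).ι ⁻¹ᵁ V) := by
    intro V hV hVa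
    rw [← (ρ ⁻¹ᵁ U).ι.isAffineOpen_iff_of_isOpenImmersion,
      Scheme.Hom.image_preimage_eq_opensRange_inf, Scheme.Opens.opensRange_ι, inf_eq_right.mpr hV]
    exact hVa
  have hG' : ∀ j, IsAffineOpen (preimageFamily (ρ ⁻¹ᵁ U).ι G j) := fun j =>
    haffι (G j) (hGle j) (hG j)
  have hG2' : ∀ j j', IsAffineOpen (preimageFamily (ρ ⁻¹ᵁ U).ι G j ⊓
      preimageFamily (ρ ⁻¹ᵁ U).ι G j') := fun j j' =>
    haffι (G j ⊓ G j') (inf_le_left.trans (hGle j)) (hG2 j j')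
  have hG3' : ∀ j j' j'', IsAffineOpen (preimageFamily (ρ ⁻¹ᵁ U).ι G j ⊓
      preimageFamily (ρ ⁻¹ᵁ U).ι G j' ⊓ preimageFamily (ρ ⁻¹ᵁ U).ι G j'') := fun j j' j'' =>
    haffι (G j ⊓ G j' ⊓ G j'') ((inf_le_left.trans inf_le_left).trans (hGle j)) (hG3 j j' j'')
  refine cechZ1_le_cechB1_of_forall_stalk ((ρ ∣_ U) ≫ hU.isoSpec.hom) (preimageFamily (ρ ⁻¹ᵁ U).ι G)
    hG' hG2' hG3' ?_
  -- (C) at a maximal ideal `𝔪 ↔ x ∈ U`: base change to `Spec 𝒪_{X,x}` and pointwise vanishing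
  intro 𝔪 h𝔪
  let y : PrimeSpectrum Γ(X, U) := ⟨𝔪, h𝔪.isPrime⟩
  have hx : hU.fromSpec.base y ∈ U := by
    have h : hU.fromSpec.base y ∈ hU.fromSpec.opensRange := ⟨y, rfl⟩
    rwa [hU.opensRange_fromSpec] at h
  letI alg : Algebra Γ(X, U) (X.presheaf.stalk (hU.fromSpec.base y)) :=
    TopCat.Presheaf.algebra_section_stalk X.presheaf ⟨hU.fromSpec.base y, hx⟩
  have hloc : IsLocalization.AtPrime (X.presheaf.stalk (hU.fromSpec.base y)) y.asIdeal :=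
    hU.isLocalization_stalk' y hx
  have hgerm : CommRingCat.ofHom (algebraMap Γ(X, U) (X.presheaf.stalk (hU.fromSpec.base y))) =
      X.presheaf.germ U (hU.fromSpec.base y) hx := rfl
  -- right square: the chart over `Spec Γ(X, U) ≅ U ⊆ X`
  have t : IsPullback (ρ ⁻¹ᵁ U).ι ((ρ ∣_ U) ≫ hU.isoSpec.hom) ρ (hU.isoSpec.inv ≫ U.ι) :=
    (isPullback_morphismRestrict ρ U).flip.of_iso (Iso.refl _) (Iso.refl _) hU.isoSpec (Iso.refl _)
      (by simp) (by simp) (by simp) (by simp)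
  -- outer square: Mathlib's base change to `Spec 𝒪_{X,x}`
  have hφ : X.fromSpecStalk (hU.fromSpec.base y) =
      Spec.map (CommRingCat.ofHom (algebraMap Γ(X, U) (X.presheaf.stalk (hU.fromSpec.base y)))) ≫
        (hU.isoSpec.inv ≫ U.ι) := by
    rw [hgerm, hU.isoSpec_inv_ι, ← hU.fromSpecStalk_eq_fromSpecStalk hx]; rfl
  have s : IsPullback (pullback.fst ρ (X.fromSpecStalk (hU.fromSpec.base y)))
      (pullback.snd ρ (X.fromSpecStalk (hU.fromSpec.base y))) ρ
      (Spec.map (CommRingCat.ofHom (algebraMap Γ(X, U) (X.presheaf.stalk (hU.fromSpec.base y)))) ≫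
        (hU.isoSpec.inv ≫ U.ι)) :=
    (IsPullback.of_hasPullback ρ (X.fromSpecStalk (hU.fromSpec.base y))).of_iso (Iso.refl _)
      (Iso.refl _) (Iso.refl _) (Iso.refl _) (by simp only [Iso.refl_hom, Category.comp_id,
        Category.id_comp]) (by simp only [Iso.refl_hom, Category.comp_id, Category.id_comp])
      (by simp only [Iso.refl_hom, Category.comp_id, Category.id_comp])
      (by simp only [Iso.refl_hom, Category.comp_id, Category.id_comp]; exact hφ)
  have H := IsPullback.of_right' s t
  refine ⟨X.presheaf.stalk (hU.fromSpec.base y), inferInstance, alg, hloc,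
    pullback ρ (X.fromSpecStalk (hU.fromSpec.base y)),
    pullback.snd ρ (X.fromSpecStalk (hU.fromSpec.base y)), _, H, ?_⟩
  -- pointwise vanishing (`hasTrivialCechH1_pullback_snd_fromSpecStalk`) in the `𝒪_{X,x}`-structure
  rw [cechZ1_le_cechB1_iff_of_base _ (pullback.snd ρ (X.fromSpecStalk (hU.fromSpec.base y)))]
  apply cechZ1_le_cechB1_of_subsingleton
  have htriv := hasTrivialCechH1_pullback_snd_fromSpecStalk ρ (hU.fromSpec.base y) h12 hρ hZ
    (hX _ hx) (hdimX _ hx)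
  haveI : IsAffineHom (t.lift (pullback.fst ρ (X.fromSpecStalk (hU.fromSpec.base y)))
      (pullback.snd ρ (X.fromSpecStalk (hU.fromSpec.base y)) ≫
        Spec.map (CommRingCat.ofHom (algebraMap Γ(X, U) (X.presheaf.stalk (hU.fromSpec.base y)))))
      (by rw [s.w, Category.assoc])) :=
    isAffineHom_isStableUnderBaseChange.of_isPullback H.flip inferInstance
  refine htriv κ _ (fun j => (hG' j).preimage _) ?_
  change ⨆ j, _ ⁻¹ᵁ ((ρ ⁻¹ᵁ U).ι ⁻¹ᵁ G j) = ⊤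
  rw [← Scheme.Hom.preimage_iSup, ← Scheme.Hom.preimage_iSup, hGcov, Scheme.Opens.ι_preimage_self]
  rfl

end ChartLocal

end Summit.ResolutionOfSingularities.ResolutionOfSingularities.Theorems.SurfaceTermination.GenusDescent

end
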